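import Literature.NumberTheory.LFunctions.LittlewoodOscillationInputs
import Literature.NumberTheory.LFunctions.NicolasJ
import Literature.NumberTheory.LFunctions.LogIntegralProofs
import HarnessLib

/-!
# MV Theorem 13.2, (13.10): `π(x) − li(x) = (ϑ(x) − x)/log x + O(x^{1/2}/log² x)` under RH — discharge of `MontgomeryVaughan2007_thm13_2`

Topic `Literature/NumberTheory/LFunctions`. This file proves the named fact
`Literature.NumberTheory.LFunctions.MontgomeryVaughan2007_thm13_2` of `LittlewoodOscillationInputs.lean`
(Montgomery–Vaughan, *Multiplicative Number Theory I*, Theorem 13.2, (13.10): "Assume RH. Then …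
`π(x) − li(x) = (ϑ(x) − x)/log x + O(x^{1/2}/(log x)²)`", `li(x) = ∫₂ˣ dt/log t`), the bridge between
(15.22) and (15.23) in Littlewood's theorem ("if RH holds, then (15.22) and (15.23) are equivalent,
in view of Theorem 13.2"). Proof as printed:

* `Thm13.pi_sub_li_sub_eq` — `π(x) = ϑ(x)/log x + ∫_2^x ϑ(t) dt/(t log² t)` ((13.5), Mathlib's
  `Chebyshev.primeCounting_eq_theta_div_log_add_integral`) and `li(x) = x/log x − 2/log 2 + ∫_2^x dt/log² t`
  (the tree's `offsetLogIntegralPow_integration_by_parts`) give, for `x ≥ 2`,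
  `π(x) − li(x) − (ϑ(x) − x)/log x = 2/log 2 + ∫_2^x (ϑ(t) − t) dt/(t log² t)`.
* `Thm13.exists_abs_Theta_le` — (13.8)–(13.9) in integrated form: under RH,
  `Θ(u) = ∫_2^u (ϑ(t) − t) dt = O(u^{3/2})`, from the tree's explicit formula for `ψ₁ = ∫ψ`
  (`norm_psiOne_sub_le_of_RH`, `exists_norm_psiOneRemainder_le`, `NicolasJ.integral_psi`) and
  `0 ≤ ψ − ϑ ≪ √x` (Mathlib's `Chebyshev.psi_sub_theta_le_mul_sqrt`).
* `Thm13.integral_theta_sub_mul_weight_eq` — integration by parts against `Θ` (which has the right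
  derivative `ϑ(u) − u` everywhere, `ϑ` being a right-continuous step function; Mathlib's
  `intervalIntegral.integral_mul_deriv_eq_deriv_mul_of_hasDeriv_right`), and
  `Thm13.integral_rpow_div_log_sq_le` — `∫_2^x t^{−1/2} dt/log² t ≤ 5x^{1/4} + 8x^{1/2}/log² x`
  (split at `√x`), whence `|π(x) − li(x) − (ϑ(x) − x)/log x| ≤ (3 + 53K) x^{1/2}/log² x` for large `x`
  (`Thm13.abs_pi_sub_li_sub_le`).
* `MontgomeryVaughan2007_thm13_2_holds` — the discharge.

## References

* [MontgomeryVaughan2007] H. L. Montgomery, R. C. Vaughan, *Multiplicative Number Theory I.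
  Classical Theory*, CUP 2007: §13.1, Theorem 13.1 (13.5)–(13.9) and Theorem 13.2 (13.10) with its
  proof (book pp. 430–431; held copy PDF pp. 322–323).
-/

noncomputable section

open Filter Topology Set MeasureTheory Asymptotics intervalIntegral
open scoped Chebyshev

namespace Literature.NumberTheory.LFunctions

namespace Thm13

open NicolasJ

/-! ### `ϑ` is a right-continuous step function; the primitive `Θ(u) = ∫_2^u (ϑ(t) − t) dt` -/

/-- `ϑ` is constant on `[t, ⌊t⌋ + 1)`, hence right-continuous. [folklore] -/
theorem theta_eventuallyEq_nhdsGT {t : ℝ} (ht : 0 ≤ t) : θ =ᶠ[𝓝[>] t] fun _ ↦ θ t := by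
  have hlt : t < ⌊t⌋₊ + 1 := Nat.lt_floor_add_one t
  filter_upwards [Ioo_mem_nhdsGT hlt] with u hu
  rw [Chebyshev.theta_eq_theta_coe_floor u, Chebyshev.theta_eq_theta_coe_floor t]
  congr 2
  rw [Nat.floor_eq_iff (ht.trans hu.1.le)]
  exact ⟨(Nat.floor_le ht).trans hu.1.le, hu.2⟩

/-- `ϑ(u) − u` is right-continuous at every `t ≥ 0`. [folklore] -/
theorem continuousWithinAt_theta_sub {t : ℝ} (ht : 0 ≤ t) :
    ContinuousWithinAt (fun u ↦ θ u - u) (Ioi t) t := by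
  have h1 : Tendsto θ (𝓝[>] t) (𝓝 (θ t)) :=
    (tendsto_congr' (theta_eventuallyEq_nhdsGT ht)).2 tendsto_const_nhds
  exact h1.sub (continuous_id.continuousWithinAt)

/-- `ϑ` is interval integrable (monotone). [folklore] -/
theorem intervalIntegrable_theta (a b : ℝ) : IntervalIntegrable θ volume a b :=
  Chebyshev.theta_mono.intervalIntegrable

/-- `ϑ(t) − t` is interval integrable. [folklore] -/
theorem intervalIntegrable_theta_sub (a b : ℝ) : IntervalIntegrable (fun t ↦ θ t - t) volume a b :=
  (intervalIntegrable_theta a b).sub (continuous_id.intervalIntegrable a b)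

/-- The primitive `Θ(u) = ∫_2^u (ϑ(t) − t) dt` is continuous. [folklore] -/
theorem continuous_Theta : Continuous fun u ↦ ∫ t in (2 : ℝ)..u, (θ t - t) :=
  continuous_primitive intervalIntegrable_theta_sub 2

/-- `Θ` has right derivative `ϑ(u) − u` at every `u ≥ 0` (FTC for a right-continuous integrand).
[folklore] -/
theorem hasDerivWithinAt_Theta {u : ℝ} (hu : 0 ≤ u) :
    HasDerivWithinAt (fun v ↦ ∫ t in (2 : ℝ)..v, (θ t - t)) (θ u - u) (Ioi u) u := by
  have hmeas : StronglyMeasurableAtFilter (fun t ↦ θ t - t) (𝓝[>] u) :=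
    ((Chebyshev.theta_mono.measurable.sub measurable_id).stronglyMeasurable).stronglyMeasurableAtFilter
  have h := integral_hasDerivWithinAt_right (intervalIntegrable_theta_sub 2 u)
    (s := Ici u) (t := Ioi u) hmeas (continuousWithinAt_theta_sub hu)
  exact h.mono Ioi_subset_Ici_self

/-! ### The RH bound `|Θ(u)| ≤ K u^{3/2}` -/

/-- `ψ₁(2) = 0`. [folklore] -/
theorem psiOne_two : psiOne 2 = 0 := by
  unfold psiOne
  rw [show ⌊(2 : ℝ)⌋₊ = 2 by norm_num]
  rw [show Finset.Ioc 0 2 = {1, 2} by decide]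
  simp

/-- **`|Θ(u)| ≤ K u^{3/2}` for `u ≥ 2`, under RH** (MV (13.8)–(13.9): `ψ₁(x) = x²/2 + O(x^{3/2})`,
here from the tree's explicit formula with the RH bound on the sum over zeros, and
`0 ≤ ∫_2^u (ψ − ϑ) ≤ C u^{3/2}` from `ψ − ϑ ≤ C√x`). [cite: MontgomeryVaughan2007, Thm. 13.1 (13.8)–(13.9)] -/
theorem exists_abs_Theta_le (hRH : RiemannHypothesis) :
    ∃ K : ℝ, 0 < K ∧ ∀ u : ℝ, 2 ≤ u → |∫ t in (2 : ℝ)..u, (θ t - t)| ≤ K * u ^ (3 / 2 : ℝ) := by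
  obtain ⟨CE, hCE0, hCE⟩ := exists_norm_psiOneRemainder_le
  obtain ⟨CM, hCM⟩ := Chebyshev.psi_sub_theta_le_mul_sqrt
  set CM' : ℝ := max CM 0 with hCM'
  have hCM'0 : 0 ≤ CM' := le_max_right _ _
  have hβ : 0 ≤ nicolasBeta := by
    have h1 := norm_psiOne_sub_le_of_RH hRH (le_refl (1 : ℝ))
    have h2 : (0 : ℝ) ≤ nicolasBeta * (1 : ℝ) ^ (3 / 2 : ℝ) := (norm_nonneg _).trans h1
    simpa using h2
  refine ⟨nicolasBeta + 9 + CE + CM', by positivity, fun u hu ↦ ?_⟩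
  have hu0 : 0 < u := by linarith
  have hu1 : 1 ≤ u := by linarith
  -- the three pieces
  have hψ : IntervalIntegrable ψ volume 2 u := intervalIntegrable_psi 2 u
  have hθ : IntervalIntegrable θ volume 2 u := intervalIntegrable_theta 2 u
  have hid : IntervalIntegrable (fun t : ℝ ↦ t) volume 2 u := continuous_id.intervalIntegrable 2 u
  have hsplit : ∫ t in (2 : ℝ)..u, (θ t - t) =
      (∫ t in (2 : ℝ)..u, ψ t) - (∫ t in (2 : ℝ)..u, (ψ t - θ t)) - ∫ t in (2 : ℝ)..u, t := by
    rw [← integral_sub hψ (hψ.sub hθ), ← integral_sub (hψ.sub (hψ.sub hθ)) hid]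
    refine integral_congr fun t _ ↦ ?_
    ring
  have hIψ : ∫ t in (2 : ℝ)..u, ψ t = psiOne u := by rw [integral_psi, psiOne_two, sub_zero]
  have hIid : ∫ t in (2 : ℝ)..u, t = (u ^ 2 - 2 ^ 2) / 2 := integral_id
  -- `|ψ₁(u) − u²/2| ≤ (β + 7 + CE) u^{3/2}`
  have hA : |psiOne u - u ^ 2 / 2| ≤ (nicolasBeta + 7 + CE) * u ^ (3 / 2 : ℝ) := by
    have h1 := norm_psiOne_sub_le_of_RH hRH hu1
    have h2 := hCE u hu0
    have hlog : ‖(u : ℂ) * Complex.log (2 * Real.pi)‖ ≤ 7 * u := by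
      rw [norm_mul, Complex.norm_real, Real.norm_eq_abs, abs_of_pos hu0,
        show (2 * Real.pi : ℂ) = ((2 * Real.pi : ℝ) : ℂ) by push_cast; ring,
        ← Complex.ofReal_log (by positivity), Complex.norm_real, Real.norm_eq_abs,
        abs_of_pos (Real.log_pos (by linarith [Real.pi_gt_three]))]
      have : Real.log (2 * Real.pi) ≤ 7 := by
        have h3 := Real.log_le_sub_one_of_pos (show 0 < 2 * Real.pi by positivity)
        linarith [Real.pi_lt_four]
      nlinarith
    have hkey : ((psiOne u - u ^ 2 / 2 : ℝ) : ℂ) =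
        ((psiOne u : ℂ) - (u : ℂ) ^ 2 / 2 + u * Complex.log (2 * Real.pi) - psiOneRemainder u) -
          (u : ℂ) * Complex.log (2 * Real.pi) + psiOneRemainder u := by
      push_cast; ring
    have hnorm : |psiOne u - u ^ 2 / 2| = ‖((psiOne u - u ^ 2 / 2 : ℝ) : ℂ)‖ := by
      rw [Complex.norm_real, Real.norm_eq_abs]
    rw [hnorm, hkey]
    have hsq : Real.sqrt u ≤ u ^ (3 / 2 : ℝ) := by
      rw [Real.sqrt_eq_rpow]
      exact Real.rpow_le_rpow_of_exponent_le hu1 (by norm_num)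
    have hu32 : u ≤ u ^ (3 / 2 : ℝ) := by
      calc u = u ^ (1 : ℝ) := (Real.rpow_one u).symm
        _ ≤ u ^ (3 / 2 : ℝ) := Real.rpow_le_rpow_of_exponent_le hu1 (by norm_num)
    calc ‖((psiOne u : ℂ) - (u : ℂ) ^ 2 / 2 + u * Complex.log (2 * Real.pi) - psiOneRemainder u) -
          (u : ℂ) * Complex.log (2 * Real.pi) + psiOneRemainder u‖
        ≤ ‖(psiOne u : ℂ) - (u : ℂ) ^ 2 / 2 + u * Complex.log (2 * Real.pi) - psiOneRemainder u‖ +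
          ‖(u : ℂ) * Complex.log (2 * Real.pi)‖ + ‖psiOneRemainder u‖ := by
          refine (norm_add_le _ _).trans ?_
          gcongr
          exact norm_sub_le _ _
      _ ≤ nicolasBeta * u ^ (3 / 2 : ℝ) + 7 * u + CE * Real.sqrt u := by gcongr
      _ ≤ nicolasBeta * u ^ (3 / 2 : ℝ) + 7 * u ^ (3 / 2 : ℝ) + CE * u ^ (3 / 2 : ℝ) := by
          gcongr
      _ = (nicolasBeta + 7 + CE) * u ^ (3 / 2 : ℝ) := by ring
  -- `0 ≤ ∫_2^u (ψ − ϑ) ≤ CM' u^{3/2}`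
  have hB0 : 0 ≤ ∫ t in (2 : ℝ)..u, (ψ t - θ t) :=
    integral_nonneg hu fun t _ ↦ sub_nonneg.2 (Chebyshev.theta_le_psi t)
  have hB : ∫ t in (2 : ℝ)..u, (ψ t - θ t) ≤ CM' * u ^ (3 / 2 : ℝ) := by
    have h1 : ∫ t in (2 : ℝ)..u, (ψ t - θ t) ≤ ∫ _ in (2 : ℝ)..u, CM' * Real.sqrt u := by
      refine integral_mono_on hu (hψ.sub hθ) (by simp) fun t ht ↦ ?_
      calc ψ t - θ t ≤ CM * Real.sqrt t := hCM t
        _ ≤ CM' * Real.sqrt t := by gcongr; exact le_max_left _ _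
        _ ≤ CM' * Real.sqrt u := by gcongr; exact ht.2
    rw [intervalIntegral.integral_const, smul_eq_mul] at h1
    have h2 : (u - 2) * (CM' * Real.sqrt u) ≤ CM' * u ^ (3 / 2 : ℝ) := by
      have hsu : Real.sqrt u * u = u ^ (3 / 2 : ℝ) := by
        rw [Real.sqrt_eq_rpow, ← Real.rpow_add_one hu0.ne']
        norm_num
      nlinarith [Real.sqrt_nonneg u, mul_nonneg hCM'0 (Real.sqrt_nonneg u)]
    linarith
  -- assemble
  rw [hsplit, hIψ, hIid]
  have e : psiOne u - (∫ t in (2 : ℝ)..u, (ψ t - θ t)) - (u ^ 2 - 2 ^ 2) / 2 =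
      (psiOne u - u ^ 2 / 2) + 2 - ∫ t in (2 : ℝ)..u, (ψ t - θ t) := by ring
  rw [e]
  have hu32' : (2 : ℝ) ≤ 2 * u ^ (3 / 2 : ℝ) := by
    have : (1 : ℝ) ≤ u ^ (3 / 2 : ℝ) := Real.one_le_rpow hu1 (by norm_num)
    linarith
  have habs := abs_le.1 hA
  rw [abs_le]
  constructor <;> nlinarith

/-! ### The exact identity `π(x) − li(x) − (ϑ(x) − x)/log x = 2/log 2 + ∫_2^x (ϑ(t) − t) dt/(t log² t)` -/

/-- The weight `w(t) = 1/(t log² t)` is continuous on `[2, x]`. [folklore] -/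
theorem continuousOn_weight {a b : ℝ} (ha : 1 < a) (hb : 1 < b) :
    ContinuousOn (fun t : ℝ ↦ (t * Real.log t ^ 2)⁻¹) (uIcc a b) := by
  refine ContinuousOn.inv₀ (continuousOn_id.mul ((Real.continuousOn_log.mono ?_).pow 2)) ?_
  · intro t ht
    simp only [mem_compl_iff, mem_singleton_iff]
    exact (zero_lt_one.trans (one_lt_of_mem_uIcc ha hb ht)).ne'
  · intro t ht
    have h1 := one_lt_of_mem_uIcc ha hb ht
    exact mul_ne_zero (by linarith) (pow_ne_zero 2 (Real.log_pos h1).ne')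
where
  /-- Auxiliary: points of `[[a, b]]` with `1 < a`, `1 < b` are `> 1`. [folklore] -/
  one_lt_of_mem_uIcc {a b t : ℝ} (ha : 1 < a) (hb : 1 < b) (ht : t ∈ uIcc a b) : 1 < t := by
    rcases le_total a b with h | h
    · rw [uIcc_of_le h] at ht; exact ha.trans_le ht.1
    · rw [uIcc_of_ge h] at ht; exact hb.trans_le ht.1

/-- **MV (13.5) combined with `li` by parts**: for `x ≥ 2`,
`π(x) − li(x) − (ϑ(x) − x)/log x = 2/log 2 + ∫_2^x (ϑ(t) − t)/(t log² t) dt`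
(`π(x) = ϑ(x)/log x + ∫_2^x ϑ(t) dt/(t log² t)`, Mathlib; `li(x) = x/log x − 2/log 2 + ∫_2^x dt/log² t`).
[cite: MontgomeryVaughan2007, Thm. 13.2 (proof, (13.5))] -/
theorem pi_sub_li_sub_eq {x : ℝ} (hx : 2 ≤ x) :
    (Nat.primeCounting ⌊x⌋₊ : ℝ) - offsetLogIntegral x - (θ x - x) / Real.log x =
      2 / Real.log 2 + ∫ t in (2 : ℝ)..x, (θ t - t) * (t * Real.log t ^ 2)⁻¹ := by
  have hx1 : 1 < x := by linarith
  have hπ := Chebyshev.primeCounting_eq_theta_div_log_add_integral hx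
  have hli : offsetLogIntegral x = x * (Real.log x)⁻¹ - 2 * (Real.log 2)⁻¹ +
      ∫ t in (2 : ℝ)..x, (Real.log t)⁻¹ ^ 2 := by
    have h := offsetLogIntegralPow_integration_by_parts 1 hx1
    rw [offsetLogIntegralPow_one] at h
    simp only [pow_one, Nat.cast_one, one_mul] at h
    rw [h]
    rfl
  have hwc := continuousOn_weight (a := 2) (b := x) one_lt_two hx1
  have hI1 : IntervalIntegrable (fun t ↦ θ t * (t * Real.log t ^ 2)⁻¹) volume 2 x :=
    (intervalIntegrable_theta 2 x).mul_continuousOn hwc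
  have hI2 : IntervalIntegrable (fun t ↦ t * (t * Real.log t ^ 2)⁻¹) volume 2 x :=
    (continuous_id.intervalIntegrable 2 x).mul_continuousOn hwc
  have hsub : ∫ t in (2 : ℝ)..x, (θ t - t) * (t * Real.log t ^ 2)⁻¹ =
      (∫ t in (2 : ℝ)..x, θ t * (t * Real.log t ^ 2)⁻¹) - ∫ t in (2 : ℝ)..x, t * (t * Real.log t ^ 2)⁻¹ := by
    rw [← integral_sub hI1 hI2]
    refine integral_congr fun t _ ↦ ?_
    ring
  have hθint : ∫ t in (2 : ℝ)..x, θ t / (t * Real.log t ^ 2) =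
      ∫ t in (2 : ℝ)..x, θ t * (t * Real.log t ^ 2)⁻¹ :=
    integral_congr fun t _ ↦ by simp only [div_eq_mul_inv]
  have hlint : ∫ t in (2 : ℝ)..x, (Real.log t)⁻¹ ^ 2 =
      ∫ t in (2 : ℝ)..x, t * (t * Real.log t ^ 2)⁻¹ := by
    refine integral_congr fun t ht ↦ ?_
    have h1 : 1 < t := continuousOn_weight.one_lt_of_mem_uIcc one_lt_two hx1 ht
    have ht0 : t ≠ 0 := by linarith
    simp only [inv_pow]
    field_simp
  have hlogx : Real.log x ≠ 0 := (Real.log_pos hx1).ne'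
  rw [hπ, hli, hsub, ← hθint, ← hlint]
  field_simp
  ring

/-! ### Integration by parts against the primitive `Θ` -/

/-- `w'(t) = −(log t + 2)/(t² log³ t)` for `t > 1`. [folklore] -/
theorem hasDerivAt_weight {t : ℝ} (ht : 1 < t) :
    HasDerivAt (fun s : ℝ ↦ (s * Real.log s ^ 2)⁻¹) (-(Real.log t + 2) / (t ^ 2 * Real.log t ^ 3)) t := by
  have ht0 : t ≠ 0 := by linarith
  have hlog : Real.log t ≠ 0 := (Real.log_pos ht).ne'
  have h1 : HasDerivAt (fun s : ℝ ↦ s * Real.log s ^ 2)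
      (1 * Real.log t ^ 2 + t * (2 * Real.log t ^ 1 * t⁻¹)) t :=
    (hasDerivAt_id t).mul ((Real.hasDerivAt_log ht0).pow 2)
  have h2 := h1.inv (mul_ne_zero ht0 (pow_ne_zero 2 hlog))
  refine h2.congr_deriv ?_
  field_simp

/-- `w'` is continuous on `[2, x]`. [folklore] -/
theorem continuousOn_weight' {x : ℝ} (hx : 1 < x) :
    ContinuousOn (fun t : ℝ ↦ -(Real.log t + 2) / (t ^ 2 * Real.log t ^ 3)) (uIcc 2 x) := by
  refine ContinuousOn.div ?_ ?_ ?_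
  · exact ((Real.continuousOn_log.mono fun t ht ↦ by
      simp only [mem_compl_iff, mem_singleton_iff]
      exact (zero_lt_one.trans (continuousOn_weight.one_lt_of_mem_uIcc one_lt_two hx ht)).ne').add
        continuousOn_const).neg
  · exact (continuousOn_id.pow 2).mul ((Real.continuousOn_log.mono fun t ht ↦ by
      simp only [mem_compl_iff, mem_singleton_iff]
      exact (zero_lt_one.trans (continuousOn_weight.one_lt_of_mem_uIcc one_lt_two hx ht)).ne').pow 3)
  · intro t ht
    have h1 := continuousOn_weight.one_lt_of_mem_uIcc one_lt_two hx ht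
    exact mul_ne_zero (pow_ne_zero 2 (by linarith)) (pow_ne_zero 3 (Real.log_pos h1).ne')

/-- **Integration by parts** (MV, proof of Thm. 13.2: "integration by parts in (13.5)"):
`∫_2^x (ϑ(t) − t) w(t) dt = Θ(x) w(x) − ∫_2^x Θ(t) w'(t) dt`, with `Θ(u) = ∫_2^u (ϑ − t)` (right
derivative `ϑ(u) − u` everywhere), `w(t) = 1/(t log² t)`. [cite: MontgomeryVaughan2007, Thm. 13.2 (proof)] -/
theorem integral_theta_sub_mul_weight_eq {x : ℝ} (hx : 2 ≤ x) :
    ∫ t in (2 : ℝ)..x, (θ t - t) * (t * Real.log t ^ 2)⁻¹ =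
      (∫ t in (2 : ℝ)..x, (θ t - t)) * (x * Real.log x ^ 2)⁻¹ -
        ∫ t in (2 : ℝ)..x, (∫ s in (2 : ℝ)..t, (θ s - s)) * (-(Real.log t + 2) / (t ^ 2 * Real.log t ^ 3)) := by
  have hx1 : 1 < x := by linarith
  have h := integral_mul_deriv_eq_deriv_mul_of_hasDeriv_right (a := 2) (b := x)
    (u := fun t : ℝ ↦ (t * Real.log t ^ 2)⁻¹)
    (u' := fun t : ℝ ↦ -(Real.log t + 2) / (t ^ 2 * Real.log t ^ 3))
    (v := fun u ↦ ∫ t in (2 : ℝ)..u, (θ t - t)) (v' := fun t ↦ θ t - t)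
    (continuousOn_weight one_lt_two hx1) continuous_Theta.continuousOn
    (fun t ht ↦ by
      rw [min_eq_left hx, max_eq_right hx] at ht
      exact (hasDerivAt_weight (by linarith [ht.1])).hasDerivWithinAt)
    (fun t ht ↦ by
      rw [min_eq_left hx, max_eq_right hx] at ht
      exact hasDerivWithinAt_Theta (by linarith [ht.1]))
    ((continuousOn_weight' hx1).intervalIntegrable) (intervalIntegrable_theta_sub 2 x)
  have hlhs : ∫ t in (2 : ℝ)..x, (θ t - t) * (t * Real.log t ^ 2)⁻¹ =
      ∫ t in (2 : ℝ)..x, (t * Real.log t ^ 2)⁻¹ * (θ t - t) :=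
    integral_congr fun t _ ↦ mul_comm _ _
  rw [hlhs, h, integral_same, mul_zero, sub_zero, mul_comm]
  congr 1
  exact integral_congr fun t _ ↦ mul_comm _ _

/-! ### The elementary integral `∫_2^x t^{-1/2} dt/log² t ≪ x^{1/4} + x^{1/2}/log² x` -/

/-- `t^{-1/2}/log² t` is interval integrable between points `> 1`. [folklore] -/
theorem intervalIntegrable_rpow_div_log_sq {a b : ℝ} (ha : 1 < a) (hb : 1 < b) :
    IntervalIntegrable (fun t : ℝ ↦ t ^ (-(1 / 2 : ℝ)) / Real.log t ^ 2) volume a b := by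
  refine ContinuousOn.intervalIntegrable ?_
  refine ContinuousOn.div ?_ ?_ ?_
  · exact ContinuousOn.rpow_const continuousOn_id fun t ht ↦
      Or.inl (zero_lt_one.trans (continuousOn_weight.one_lt_of_mem_uIcc ha hb ht)).ne'
  · exact (Real.continuousOn_log.mono fun t ht ↦ by
      simp only [mem_compl_iff, mem_singleton_iff]
      exact (zero_lt_one.trans (continuousOn_weight.one_lt_of_mem_uIcc ha hb ht)).ne').pow 2
  · intro t ht
    exact pow_ne_zero 2 (Real.log_pos (continuousOn_weight.one_lt_of_mem_uIcc ha hb ht)).ne'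

/-- `∫_a^b t^{-1/2} dt = 2(b^{1/2} − a^{1/2})` (Mathlib's `integral_rpow`; no positivity needed
for the exponent `−1/2 > −1`). [folklore] -/
theorem integral_rpow_neg_half (a b : ℝ) :
    ∫ t in a..b, t ^ (-(1 / 2 : ℝ)) = 2 * (b ^ (1 / 2 : ℝ) - a ^ (1 / 2 : ℝ)) := by
  rw [integral_rpow (Or.inl (by norm_num : (-1 : ℝ) < -(1 / 2)))]
  rw [show (-(1 / 2 : ℝ) + 1) = 1 / 2 by norm_num]
  field_simp

/-- For `x ≥ 16`: `∫_2^x t^{-1/2}/log² t dt ≤ 5 x^{1/4} + 8 x^{1/2}/log² x` (split at `√x`).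
[folklore] -/
theorem integral_rpow_div_log_sq_le {x : ℝ} (hx : 16 ≤ x) :
    ∫ t in (2 : ℝ)..x, t ^ (-(1 / 2 : ℝ)) / Real.log t ^ 2 ≤
      5 * x ^ (1 / 4 : ℝ) + 8 * x ^ (1 / 2 : ℝ) / Real.log x ^ 2 := by
  have hx0 : 0 < x := by linarith
  have hx1 : 1 < x := by linarith
  set m : ℝ := x ^ (1 / 2 : ℝ) with hm
  have hm2 : 2 ≤ m := by
    have h16 : (16 : ℝ) ^ (1 / 2 : ℝ) = 4 := by
      rw [show (16 : ℝ) = 4 ^ (2 : ℝ) by norm_num, ← Real.rpow_mul (by norm_num)]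
      norm_num
    have : (16 : ℝ) ^ (1 / 2 : ℝ) ≤ m := Real.rpow_le_rpow (by norm_num) hx (by norm_num)
    linarith
  have hmx : m ≤ x := by
    calc m = x ^ (1 / 2 : ℝ) := rfl
      _ ≤ x ^ (1 : ℝ) := Real.rpow_le_rpow_of_exponent_le hx1.le (by norm_num)
      _ = x := Real.rpow_one x
  have hm0 : 0 < m := by linarith
  have hm14 : m ^ (1 / 2 : ℝ) = x ^ (1 / 4 : ℝ) := by
    rw [hm, ← Real.rpow_mul hx0.le]; norm_num
  have hlogm : Real.log m = Real.log x / 2 := by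
    rw [hm, Real.log_rpow hx0]; ring
  have hlogx : 0 < Real.log x := Real.log_pos hx1
  have hl2 : (1 : ℝ) / 2 < Real.log 2 := by linarith [Real.log_two_gt_d9]
  -- integrability of the integrand on both pieces
  have hcont : ∀ a b : ℝ, 1 < a → 1 < b →
      IntervalIntegrable (fun t : ℝ ↦ t ^ (-(1 / 2 : ℝ)) / Real.log t ^ 2) volume a b :=
    fun a b ha hb ↦ intervalIntegrable_rpow_div_log_sq ha hb
  have hrpow : ∀ a b : ℝ, 0 < a → 0 < b →
      IntervalIntegrable (fun t : ℝ ↦ t ^ (-(1 / 2 : ℝ))) volume a b := by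
    intro a b ha hb
    refine intervalIntegral.intervalIntegrable_rpow (Or.inr fun h ↦ ?_)
    rcases le_total a b with hab | hab
    · rw [uIcc_of_le hab] at h; linarith [h.1]
    · rw [uIcc_of_ge hab] at h; linarith [h.1]
  rw [← integral_add_adjacent_intervals (hcont 2 m one_lt_two (by linarith))
    (hcont m x (by linarith) hx1)]
  -- piece `[2, m]`
  have hP1 : ∫ t in (2 : ℝ)..m, t ^ (-(1 / 2 : ℝ)) / Real.log t ^ 2 ≤ 5 * x ^ (1 / 4 : ℝ) := by
    have h1 : ∫ t in (2 : ℝ)..m, t ^ (-(1 / 2 : ℝ)) / Real.log t ^ 2 ≤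
        ∫ t in (2 : ℝ)..m, (Real.log 2 ^ 2)⁻¹ * t ^ (-(1 / 2 : ℝ)) := by
      refine integral_mono_on hm2 (hcont 2 m one_lt_two (by linarith))
        ((hrpow 2 m two_pos hm0).const_mul _) fun t ht ↦ ?_
      have ht2 : 2 ≤ t := ht.1
      have hlt : Real.log 2 ≤ Real.log t := Real.log_le_log two_pos ht2
      have hpos : 0 < t ^ (-(1 / 2 : ℝ)) := Real.rpow_pos_of_pos (by linarith) _
      rw [div_eq_mul_inv, mul_comm]
      gcongr
    rw [intervalIntegral.integral_const_mul, integral_rpow_neg_half 2 m, hm14] at h1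
    have hl22 : (9 / 20 : ℝ) ≤ Real.log 2 ^ 2 := by
      have := Real.log_two_gt_d9
      nlinarith
    have hinv : (Real.log 2 ^ 2)⁻¹ ≤ 20 / 9 := by
      rw [inv_le_comm₀ (by positivity) (by norm_num)]; linarith
    have h2pos : 0 ≤ (2 : ℝ) ^ (1 / 2 : ℝ) := Real.rpow_nonneg (by norm_num) _
    have hx14 : 0 ≤ x ^ (1 / 4 : ℝ) := Real.rpow_nonneg hx0.le _
    calc ∫ t in (2 : ℝ)..m, t ^ (-(1 / 2 : ℝ)) / Real.log t ^ 2
        ≤ (Real.log 2 ^ 2)⁻¹ * (2 * (x ^ (1 / 4 : ℝ) - (2 : ℝ) ^ (1 / 2 : ℝ))) := h1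
      _ ≤ (20 / 9) * (2 * x ^ (1 / 4 : ℝ)) := by
          have : 2 * (x ^ (1 / 4 : ℝ) - (2 : ℝ) ^ (1 / 2 : ℝ)) ≤ 2 * x ^ (1 / 4 : ℝ) := by linarith
          calc (Real.log 2 ^ 2)⁻¹ * (2 * (x ^ (1 / 4 : ℝ) - (2 : ℝ) ^ (1 / 2 : ℝ)))
              ≤ (Real.log 2 ^ 2)⁻¹ * (2 * x ^ (1 / 4 : ℝ)) := by
                exact mul_le_mul_of_nonneg_left this (by positivity)
            _ ≤ (20 / 9) * (2 * x ^ (1 / 4 : ℝ)) := by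
                exact mul_le_mul_of_nonneg_right hinv (by positivity)
      _ ≤ 5 * x ^ (1 / 4 : ℝ) := by nlinarith
  -- piece `[m, x]`
  have hP2 : ∫ t in m..x, t ^ (-(1 / 2 : ℝ)) / Real.log t ^ 2 ≤ 8 * x ^ (1 / 2 : ℝ) / Real.log x ^ 2 := by
    have h1 : ∫ t in m..x, t ^ (-(1 / 2 : ℝ)) / Real.log t ^ 2 ≤
        ∫ t in m..x, (Real.log m ^ 2)⁻¹ * t ^ (-(1 / 2 : ℝ)) := by
      refine integral_mono_on hmx (hcont m x (by linarith) hx1)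
        ((hrpow m x hm0 hx0).const_mul _) fun t ht ↦ ?_
      have htm : m ≤ t := ht.1
      have hlt : Real.log m ≤ Real.log t := Real.log_le_log hm0 htm
      have hlogm0 : 0 < Real.log m := by rw [hlogm]; positivity
      have hpos : 0 < t ^ (-(1 / 2 : ℝ)) := Real.rpow_pos_of_pos (by linarith) _
      rw [div_eq_mul_inv, mul_comm]
      gcongr
    rw [intervalIntegral.integral_const_mul, integral_rpow_neg_half m x, hlogm] at h1
    have hx12 : 0 ≤ x ^ (1 / 2 : ℝ) := Real.rpow_nonneg hx0.le _
    have hm12 : 0 ≤ m ^ (1 / 2 : ℝ) := Real.rpow_nonneg hm0.le _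
    calc ∫ t in m..x, t ^ (-(1 / 2 : ℝ)) / Real.log t ^ 2
        ≤ ((Real.log x / 2) ^ 2)⁻¹ * (2 * (x ^ (1 / 2 : ℝ) - m ^ (1 / 2 : ℝ))) := h1
      _ ≤ ((Real.log x / 2) ^ 2)⁻¹ * (2 * x ^ (1 / 2 : ℝ)) := by
          refine mul_le_mul_of_nonneg_left (by linarith) (by positivity)
      _ = 8 * x ^ (1 / 2 : ℝ) / Real.log x ^ 2 := by
          field_simp
          ring
  linarith

/-! ### Assembly -/

/-- `(log t + 2)/log³ t ≤ 4/log² t` for `t ≥ 2` (`log 2 ≥ 2/3`). [folklore] -/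
theorem log_add_two_div_le {t : ℝ} (ht : 2 ≤ t) :
    (Real.log t + 2) / Real.log t ^ 3 ≤ 4 / Real.log t ^ 2 := by
  have hl2 : (2 : ℝ) / 3 ≤ Real.log 2 := by linarith [Real.log_two_gt_d9]
  have hlog : Real.log 2 ≤ Real.log t := Real.log_le_log two_pos ht
  have hlogpos : 0 < Real.log t := by linarith
  rw [div_le_div_iff₀ (by positivity) (by positivity)]
  have : Real.log t + 2 ≤ 4 * Real.log t := by linarith
  nlinarith [pow_pos hlogpos 2]

/-- **The error term** (MV, proof of Thm. 13.2): under RH, for `x ≥ 16` with `log² x ≤ x^{1/4}` and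
`log x ≥ 1`, `|π(x) − li(x) − (ϑ(x) − x)/log x| ≤ (3 + 53K) x^{1/2}/log² x`, `K` the constant of
`exists_abs_Theta_le`. [cite: MontgomeryVaughan2007, Thm. 13.2 (13.10)] -/
theorem abs_pi_sub_li_sub_le {K : ℝ} (hK0 : 0 < K)
    (hK : ∀ u : ℝ, 2 ≤ u → |∫ t in (2 : ℝ)..u, (θ t - t)| ≤ K * u ^ (3 / 2 : ℝ))
    {x : ℝ} (hx : 16 ≤ x) (hlog2 : Real.log x ^ 2 ≤ x ^ (1 / 4 : ℝ)) (hlog1 : 1 ≤ Real.log x) :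
    |(Nat.primeCounting ⌊x⌋₊ : ℝ) - offsetLogIntegral x - (θ x - x) / Real.log x| ≤
      (3 + 53 * K) * (x ^ (1 / 2 : ℝ) / Real.log x ^ 2) := by
  have hx2 : 2 ≤ x := by linarith
  have hx0 : 0 < x := by linarith
  have hx1 : 1 < x := by linarith
  have hlogpos : 0 < Real.log x := by linarith
  rw [pi_sub_li_sub_eq hx2, integral_theta_sub_mul_weight_eq hx2]
  -- the three terms
  have hT1 : |2 / Real.log 2| ≤ 3 := by
    have hl2 : (2 : ℝ) / 3 < Real.log 2 := by linarith [Real.log_two_gt_d9]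
    rw [abs_of_pos (by positivity), div_le_iff₀ (by linarith)]
    linarith
  have hT2 : |(∫ t in (2 : ℝ)..x, (θ t - t)) * (x * Real.log x ^ 2)⁻¹| ≤
      K * (x ^ (1 / 2 : ℝ) / Real.log x ^ 2) := by
    have hwpos : (0 : ℝ) < (x * Real.log x ^ 2)⁻¹ := inv_pos.2 (mul_pos hx0 (pow_pos hlogpos 2))
    rw [abs_mul, abs_of_pos hwpos]
    have h32 : x ^ (3 / 2 : ℝ) = x * x ^ (1 / 2 : ℝ) := by
      rw [show (3 / 2 : ℝ) = 1 + 1 / 2 by norm_num, Real.rpow_add hx0, Real.rpow_one]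
    calc |∫ t in (2 : ℝ)..x, (θ t - t)| * (x * Real.log x ^ 2)⁻¹
        ≤ K * x ^ (3 / 2 : ℝ) * (x * Real.log x ^ 2)⁻¹ := by
          exact mul_le_mul_of_nonneg_right (hK x hx2) (by positivity)
      _ = K * (x ^ (1 / 2 : ℝ) / Real.log x ^ 2) := by
          rw [h32]; field_simp
  have hT3 : |∫ t in (2 : ℝ)..x, (∫ s in (2 : ℝ)..t, (θ s - s)) * (-(Real.log t + 2) / (t ^ 2 * Real.log t ^ 3))| ≤
      4 * K * (5 * x ^ (1 / 4 : ℝ) + 8 * x ^ (1 / 2 : ℝ) / Real.log x ^ 2) := by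
    have hint : IntervalIntegrable (fun t ↦ (∫ s in (2 : ℝ)..t, (θ s - s)) *
        (-(Real.log t + 2) / (t ^ 2 * Real.log t ^ 3))) volume 2 x :=
      (continuous_Theta.intervalIntegrable 2 x).mul_continuousOn (continuousOn_weight' hx1)
    refine (abs_integral_le_integral_abs hx2).trans ?_
    have hmono : ∫ t in (2 : ℝ)..x, |(∫ s in (2 : ℝ)..t, (θ s - s)) *
        (-(Real.log t + 2) / (t ^ 2 * Real.log t ^ 3))| ≤
        ∫ t in (2 : ℝ)..x, 4 * K * (t ^ (-(1 / 2 : ℝ)) / Real.log t ^ 2) := by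
      refine integral_mono_on hx2 hint.abs
        ((intervalIntegrable_rpow_div_log_sq one_lt_two hx1).const_mul _) fun t ht ↦ ?_
      have ht2 : 2 ≤ t := ht.1
      have ht0 : 0 < t := by linarith
      have hlogt : 0 < Real.log t := Real.log_pos (by linarith)
      rw [abs_mul, abs_div, abs_neg, abs_of_pos (by positivity : 0 < Real.log t + 2),
        abs_of_pos (by positivity : 0 < t ^ 2 * Real.log t ^ 3)]
      have h32 : t ^ (3 / 2 : ℝ) / t ^ 2 = t ^ (-(1 / 2 : ℝ)) := by
        rw [show (t ^ 2 : ℝ) = t ^ (2 : ℝ) by norm_cast, ← Real.rpow_sub ht0]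
        norm_num
      calc |∫ s in (2 : ℝ)..t, (θ s - s)| * ((Real.log t + 2) / (t ^ 2 * Real.log t ^ 3))
          ≤ K * t ^ (3 / 2 : ℝ) * ((Real.log t + 2) / (t ^ 2 * Real.log t ^ 3)) :=
            mul_le_mul_of_nonneg_right (hK t ht2) (by positivity)
        _ = K * (t ^ (3 / 2 : ℝ) / t ^ 2) * ((Real.log t + 2) / Real.log t ^ 3) := by
            field_simp
        _ ≤ K * (t ^ (3 / 2 : ℝ) / t ^ 2) * (4 / Real.log t ^ 2) :=
            mul_le_mul_of_nonneg_left (log_add_two_div_le ht2) (by positivity)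
        _ = 4 * K * (t ^ (-(1 / 2 : ℝ)) / Real.log t ^ 2) := by
            rw [h32]; ring
    refine hmono.trans ?_
    rw [intervalIntegral.integral_const_mul]
    exact mul_le_mul_of_nonneg_left (integral_rpow_div_log_sq_le hx) (by positivity)
  -- `x^{1/4} ≤ x^{1/2}/log² x` and `1 ≤ x^{1/2}/log² x`
  have hx14 : 0 < x ^ (1 / 4 : ℝ) := Real.rpow_pos_of_pos hx0 _
  have hhalf : x ^ (1 / 2 : ℝ) = x ^ (1 / 4 : ℝ) * x ^ (1 / 4 : ℝ) := by
    rw [← Real.rpow_add hx0]; norm_num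
  have hQ : x ^ (1 / 4 : ℝ) ≤ x ^ (1 / 2 : ℝ) / Real.log x ^ 2 := by
    rw [le_div_iff₀ (by positivity), hhalf]
    exact mul_le_mul_of_nonneg_left hlog2 hx14.le
  have hone : 1 ≤ x ^ (1 / 4 : ℝ) := Real.one_le_rpow hx1.le (by norm_num)
  have hQ1 : 1 ≤ x ^ (1 / 2 : ℝ) / Real.log x ^ 2 := hone.trans hQ
  calc |2 / Real.log 2 + ((∫ t in (2 : ℝ)..x, (θ t - t)) * (x * Real.log x ^ 2)⁻¹ -
          ∫ t in (2 : ℝ)..x, (∫ s in (2 : ℝ)..t, (θ s - s)) * (-(Real.log t + 2) / (t ^ 2 * Real.log t ^ 3)))|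
      ≤ |2 / Real.log 2| + (|(∫ t in (2 : ℝ)..x, (θ t - t)) * (x * Real.log x ^ 2)⁻¹| +
          |∫ t in (2 : ℝ)..x, (∫ s in (2 : ℝ)..t, (θ s - s)) * (-(Real.log t + 2) / (t ^ 2 * Real.log t ^ 3))|) := by
        refine (abs_add_le _ _).trans ?_
        gcongr
        exact abs_sub _ _
    _ ≤ 3 + (K * (x ^ (1 / 2 : ℝ) / Real.log x ^ 2) +
          4 * K * (5 * x ^ (1 / 4 : ℝ) + 8 * x ^ (1 / 2 : ℝ) / Real.log x ^ 2)) := by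
        gcongr
    _ ≤ 3 * (x ^ (1 / 2 : ℝ) / Real.log x ^ 2) + (K * (x ^ (1 / 2 : ℝ) / Real.log x ^ 2) +
          4 * K * (5 * (x ^ (1 / 2 : ℝ) / Real.log x ^ 2) + 8 * (x ^ (1 / 2 : ℝ) / Real.log x ^ 2))) := by
        have h8 : 8 * x ^ (1 / 2 : ℝ) / Real.log x ^ 2 = 8 * (x ^ (1 / 2 : ℝ) / Real.log x ^ 2) := by ring
        rw [h8]
        gcongr
        linarith
    _ = (3 + 53 * K) * (x ^ (1 / 2 : ℝ) / Real.log x ^ 2) := by ring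

end Thm13

/-- **Discharge of `MontgomeryVaughan2007_thm13_2`** (MV Theorem 13.2, (13.10): under RH,
`π(x) − li(x) = (ϑ(x) − x)/log x + O(x^{1/2}/(log x)²)`, `li = ∫₂ˣ dt/log t`). Proof as printed:
`π(x) = ϑ(x)/log x + ∫_2^x ϑ(t) dt/(t log² t)` (13.5) and `li` by parts give
`π − li − (ϑ − x)/log x = 2/log 2 + ∫_2^x (ϑ(t) − t) dt/(t log² t)`; integrating by parts against
`Θ(u) = ∫_2^u (ϑ − t) = O(u^{3/2})` ((13.8)–(13.9), from the explicit formula for `ψ₁` under RH and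
`ψ − ϑ ≪ √x`) bounds the integral by `≪ x^{1/2}/log² x + ∫_2^x t^{−1/2} dt/log² t ≪ x^{1/2}/log² x`.
[cite: MontgomeryVaughan2007, Thm. 13.2 (13.10)] -/
theorem MontgomeryVaughan2007_thm13_2_holds : MontgomeryVaughan2007_thm13_2 := by
  intro hRH
  obtain ⟨K, hK0, hK⟩ := Thm13.exists_abs_Theta_le hRH
  refine IsBigO.of_bound (3 + 53 * K) ?_
  filter_upwards [eventually_ge_atTop (16 : ℝ), eventually_ge_atTop (Real.exp 1),
    (isLittleO_log_rpow_atTop (by norm_num : (0 : ℝ) < 1 / 8)).bound one_pos] with x hx hxe hlog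
  have hx0 : 0 < x := by linarith
  have hx1 : 1 < x := by linarith
  have hlogpos : 0 < Real.log x := Real.log_pos hx1
  have hlog1 : 1 ≤ Real.log x := by
    rw [← Real.log_exp 1]; exact Real.log_le_log (Real.exp_pos 1) hxe
  rw [Real.norm_eq_abs, Real.norm_eq_abs, abs_of_pos hlogpos, one_mul,
    abs_of_pos (Real.rpow_pos_of_pos hx0 _)] at hlog
  have hlog2 : Real.log x ^ 2 ≤ x ^ (1 / 4 : ℝ) := by
    calc Real.log x ^ 2 ≤ (x ^ (1 / 8 : ℝ)) ^ 2 := pow_le_pow_left₀ hlogpos.le hlog 2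
      _ = x ^ (1 / 4 : ℝ) := by
          rw [← Real.rpow_natCast, ← Real.rpow_mul hx0.le]; norm_num
  have h := Thm13.abs_pi_sub_li_sub_le hK0 hK hx hlog2 hlog1
  rw [Real.norm_eq_abs, Real.norm_eq_abs,
    abs_of_pos (div_pos (Real.rpow_pos_of_pos hx0 _) (pow_pos hlogpos 2))]
  exact h

end Literature.NumberTheory.LFunctions
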